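import Literature.MathematicalPhysics.QuantumFieldTheory.Balaban1983to89.B9Cor36GCubeEntriesAtV
import Literature.MathematicalPhysics.QuantumFieldTheory.Balaban1983to89.B9Cor36BondSandwichTransfer
import Literature.MathematicalPhysics.QuantumFieldTheory.Balaban1983to89.B9Cor36GCubeLocLetter
import Literature.MathematicalPhysics.QuantumFieldTheory.Balaban1983to89.B9Thm310CutoffLapTermsB

/-!
# `Balaban1983to89.B9Cor36GCubeLocAtMember` — [Balaban1985BackgroundPropagators] COROLLARY 3.6 p. 408 + (3.87)–(3.89) p. 409 AT ONE COVER CUBE □,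
# READ AT THE MEMBER, BOND SECTOR: the (3.42)-block `hE` of the bond writer for the cube letter `O_□ = M_{χ_□}R(u)⁻¹G_□(Ṽ_□)R(u)M_{χ_□}` of
# design (R) — the four entries `|O_□J|, |∇_U O_□J|, |O_□∇*_U J|, |Δ_U O_□J| ≦ B₀(1+B₂)[(Lⁿη)², Lⁿη, Lⁿη, 1]e^{−δd}|J|` with the MEMBER's covariant bond
# derivatives, over the member's geometry, from G-F6a's cube-side entries at `Ṽ_□` MODULO the flat right entry (sub-row G-B9-LETTERS, module
# M5.1b-G «Cor 3.5∕3.6 for the bond-sector cube letter G_□ = Δ_{a,□}⁻¹», FILE G-F6b; the bond twin of p33's site-sector FILE 7b-D2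
# `B9Cor36GpCubeLocAtMember`)

T. Bałaban, *Propagators for lattice gauge theories in a background field*, Commun. Math. Phys. **99** (1985) 389–434
[`Balaban1985BackgroundPropagators`, "B9"]; [4] = T. Bałaban, *Propagators and renormalization transformations for lattice gauge theories. II*,
Commun. Math. Phys. **96** (1984) 223–250 [`Balaban1984PropagatorsII`].

statement-level skeleton of published theorems with citation tags; proofs where landed; nothing here is a claim about the
Yang–Mills mass gap

THE PRINTED LOCUS (verbatim, held `paper:balaban1985-cmp99-background-propagators`, journal page = PDF page + 388; page owner r06).  Cor. 3.6 p. 408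
l. 1–10: *«If a configuration U satisfies (3.35) with O(1)Mα₀ ≦ a₁, and Ω′₀ ⊂ □ for a cube □ of the class described in this condition, then Theorems 3.1-3.3
hold for the operators G′(U), (Q′(U)G′²(U)Q′\*(U))⁻¹, G(U) constructed for the sequence {Ω′_j}»*, *«The operators are gauge invariant, so it is enough
to prove the corollary for U′ = U^u = e^{iηA}»*; p. 409 l. 1–5 (the cube operators `G_□(U)`), (3.87) p. 409 (`G′₀(U) = Σ_□ h_□G′_□(U)h_□`), (3.88)–(3.89)
p. 409 (the commutator of `Δ′(U)` with the cut-offs `h_□`: first-order terms against `∇G′_□`, the second difference against `G′_□`); p. 410 l. 14–15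
(localisation of the background to the cube); (3.28) p. 395 *«(R(u)U′)(x, x′) = R(u(x))U′(x, x′)»*, (3.31) p. 395 (`∇_{U^u}R(u) = R(u)∇_U` etc.); (3.3)
p. 390, (3.8) p. 392, (3.23) p. 394 (`∇_{U,μ}`, `∇\*_{U,μ}`, `Δ_U` on bond functions); (3.100) p. 413 (the lattice Leibniz rule, «similarly for adjoint
derivatives»); Thm 3.3 p. 399 with Thm 3.1 (3.42) p. 397 (*«with λ replaced by a function J defined at bonds»*); Thm 3.4 p. 400.  [4] (2.39)–(2.44)
pp. 229–230, (2.51)–(2.55) p. 232, p. 247 *«|∂h_□| ≦ O(1)(MLʲη)⁻¹, |Δh_□| ≦ O(1)(MLʲη)⁻²»*.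

WHY THIS FILE (cell `lit-balaban`; module M5.1b-G, p38 g44; successor plan of `lit-balaban-p38/RECORD-M51bG-g43.md` §Remaining item 3).  M5.7's consumer
`B9Thm310DeltaAIsUnitOfExpansion.eBlock_kernelFamilyBInv_GAY_of_localInverseCubes''` needs, per cover cube □, the binder `hE : EBlock (kernelFamilyBInv i B
cfg (fun _ => locLetterBY i □ parS parB u χ_□ Ṽ_□) par) B₀ δ U₁` — the four (3.42) entries of the localised, transported, cut-off cube letter `O_□` (G-F2∕G-F3
`B9Cor36GCubeLocLetter.locLetterBY`) with the MEMBER's derivatives `∇_{U,ν}`, `∇\*_{U,ν}`, `Δ_U` (def-Y's `cdB (cfg U₁) ν`, `cdsB`, `lapB`).  G-F6a v1.1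
(`B9Cor36GCubeEntriesAtV.cor36_G_cube_entries_at_locCfg'`) delivers the entries of `G_□(Ṽ_□)` with the COVARIANT derivatives AT `Ṽ_□` over the CUBE
SEQUENCE's blocks (both left first-order orientations, the Laplacian, and the right entry modulo its flat half); G-F6b-T (`B9Cor36BondSandwichTransfer`)
transfers block majorants of sandwiches `M_{g₁}R(γ)⁻¹MR(γ)M_{g₂}` from the cube sequence's blocks to the member's.  THIS FILE writes the member derivatives
of `O_□` as sums of such sandwiches of G-F6a's cube operators — print's two sentences «gauge invariant» ((3.31): `∇_U R(u)⁻¹ = R(u)⁻¹∇_{U^u}`) and «U′ = U^u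
= e^{iηA}» localised to the cube (`U^u = Ṽ_□` on the bond variables near `supp χ_□`, p. 410 l. 14–15), with the lattice Leibniz rule (3.100) through the
cut-off `χ_□` producing the (3.88)–(3.89) commutator terms — and assembles `hE` by the bond writer `B9CubeLettersInvWriteDictB.eBlock_kernelFamilyBInv_of_hasMajorant`.

WHAT THIS FILE PROVES (THEOREMS + `def`s with bodies `GinB` (`G_□(Ṽ_□)` in `End_ℝ`), `GmemB` (`O_□` in `End_ℝ`) and the `abbrev` `SandB`; 0 `def … : Prop`,
0 sorry).
* §1 POINTWISE, BOND SECTOR: `conjY_conjY_inv`, `conjY_inv_apply'` (any carrier), `cdB_congr_pt` ∕ `cdsB_congr_pt` ∕ `lapB_congr_pt` (the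
  derivatives at a bond depend on `U` only through the bond variables `U_ν(f₋)`, `U_ν(f₋ − e_ν)`), ★ `transport_fwd` ∕ ★ `transport_bwd` ∕ ★ `transport_lap`
  (`∇_{U,μ}R(u)⁻¹Ψ = R(u)⁻¹∇_{Ṽ,μ}Ψ` at a bond where `U^u = Ṽ` on the variable read; readings' `cdB_conj` ∕ `cdsB_conj` ∕ `lapB_conj`), `transport_fwd'`
  (the Leibniz-remainder shape), ★ `Rinv_cdB_unshift_eq_neg_cdsB` (`R(U_μ(f₋ − e_μ))⁻¹(∇_{U,μ}A)(f − e_μ) = −(∇\*_{U,μ}A)(f)`: the backward term of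
  `lapB_cutMulY_apply` IS the backward covariant derivative), `cutMul_cdsB_shift` (`χ∇\* = ∇\*χ⁺ + c_f∂⁺χ`), ★ `transport_bwd_right`.
* §2 LETTERS AND IDENTITIES: `SandB` (G-F6b-T's sandwich shape verbatim), `sandB_apply`, `GinB`, `conj_GinB` (`= GVK`, `rfl`), `GinB_apply`, `GmemB`, ★
  `GmemB_apply` (`GmemB = locLetterBY …`, `rfl` — the writer's `hG`), `GmemB_apply_fun`, `agree_src`; ★★ `cdBₗ_mul_GmemB` (`∇_{U,μ}·O_□ = Sand(χ⁺, ∇_{Ṽ,μ}G_□,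
  χ) + Sand(c_f∂⁺_μχ, G_□, χ)`), ★★ `GmemB_mul_cdsBₗ` (`O_□·∇\*_{U,μ} = Sand(χ, G_□∇\*_{Ṽ,μ}, χ⁺) + Sand(χ, G_□, c_f∂⁺_μχ)`), ★★ `lapBₗ_mul_GmemB` (`Δ_U·O_□ =
  Sand(χ, Δ_{Ṽ}G_□, χ) − Σ_μ[Sand(c_f∂⁻_μχ, ∇\*_{Ṽ,μ}G_□, χ) + Sand(c_f∂⁺_μχ, ∇_{Ṽ,μ}G_□, χ) + Sand(c_f²∂_μ∂\*_μχ, G_□, χ)]`), under the agreement binder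
  `hAG` on `N ⊇ {χ_□ ≠ 0 at z, z ± e_μ}` (p33's `agree_near` supplies it from the (3.35) datum).
* §3 `abs_cf_mul`, `abs_cf_sq_mul`, ★★★ `eBlock_locLetterBY`: under G-F6a's hypothesis list VERBATIM (the (3.35) cube datum `(A; Q, C, ξ, Λ)` of Hermitian type,
  member thresholds, `sRead C Λ ≦ a₁`) + the gauge `u` (bi-contractive, `U^u = e^{iηA}` on the bonds of `Q`) + any background family through `U` + the FLAT
  RIGHT ENTRY `GVK(Ṽ_□)·conj b(∇\*_{1,ν}) ≺ B₂·Lⁿη·e^{−ρ′d_□}` (all `ν`, `0 < ρ′ ≦ δ`, `B₂ ≧ 0`; displayed): `IsUnit Δ_{a,□}(Ṽ_□)` ∧ `EBlock (kernelFamilyBInv i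
  B cfg (fun _ => O_□) par) (B₀(1 + B₂)) ((1 − 9∕5000)ρ′) U₁`; `δ` = G-F6a's, `B₀ = M₂Σ‖b_j‖·(B_{c,0} + (M₂Σ‖b_j‖)²)` with `B_{c,0}` an explicit polynomial in
  G-F6a's `B_f`, `D₁θ`, `D₂θ`, `L⁴`, `d + 1`; `T₀` = G-F6a's joined with the scale-transfer threshold `4 log L∕(κδ)`.

PROOF.  Ours, following print's two sentences and (3.88)–(3.89): p33's FILE 7b-D2 architecture VERBATIM on the bond carrier (§1 ↔ its §1, §2 ↔ its §2 with
`c_f` inside the derivatives instead of the `η⁻¹` letters, §3 ↔ its §4), with def-Y's bond Leibniz rules `B9Eq3104CutoffCommutators.cdB_cutMulY_apply`,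
`B9Thm310CutoffLapTermsB.lapB_cutMulY_apply`, readings' covariance `B9CubeLettersInvReadings.cdB_conj ∕ cdsB_conj ∕ lapB_conj`, p33's `agree_near` ∕
`nearC_of_chiY_ne_zero₃` (agreement) and `B9Cor36CutoffSecondDiff.chiY_weights` ∕ `nearH_of_chiY_ne_zero₃` (multiplier sizes, supports) BY NAME, G-F6b-T's
`hasMajorant_conj_bond_sandwich_decay(_src)`, G-F6a v1.1, and the bond writer.

HONEST SCOPE ∕ NOT CLAIMED.  `[NormOneClass 𝔸]`; the (3.35) cube datum, Hermitian type, thresholds, `sRead C Λ ≦ a₁`, the gauge `u` with `U^u = e^{iηA}` on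
`Q` are displayed hypotheses (as G-F6a ∕ p33's 7b-D2); `parS = parSymY i`, `parB = parBY i`; the (3.42)₃ FLAT RIGHT ENTRY of `G_□(Ṽ_□)` over the cube
sequence's blocks is a DISPLAYED HYPOTHESIS (cell GAPS G-B9-02: p33 g101's RIGHT-ENTRY-L0 chain `B6…V1L0` → `B9Thm33CubeAtOneRight` supplies `G_□(1)·∇\*`,
r06's `B9Ineq386RightEntry.gExt_rightEntry_of_386L` its transfer to `Ṽ_□`; print p. 398: «we may always replace ∇_U by ∇\*_U»); the defect majorants of the
left∕transposed laws (`locDefectBY`, `locDefectTBY`, the consumer's `hdef`∕`hdefT`) are NOT treated here; constants unoptimised; Hölder ∕ L² ∕ (3.43)–(3.47)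
entries NOT treated; nothing on `d = 4`, the continuum, reflection positivity; NOT a node discharge; no summit ∕ sub-problem statement is proved; YM mass gap
NOT proved by any of this (Track A conditional rung).  No `sorry`, no `axiom`, no `… : Prop` fact, no `instance`, no `notation`.  NEW file; nothing landed is
modified.  Cell `lit-balaban`, seat `lit-balaban-p38` gen 44, 2026-08-28; `--supports stmt-QuantumFields-19200` as helper.  Net new unproved facts: 0.

RELATED IN THE TREE, NOT DUPLICATED (searched 2026-08-28: `rg 'GCubeLocAtMember|GmemB|SandB |GinB|cdBₗ_mul_Gmem|transport_fwd'` over `Literature/`: only p33's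
SITE-sector `B9Cor36GpCubeLocAtMember` (`SandR`, `Ginner`, `Gmem`, `transport_fwd` on `SiteY`; its `agree_near`, `nearC_of_chiY_ne_zero₃`, `hasMajorant_congr_op`,
`hasMajorant_finset_sum`, `kernel_le` USED BY NAME)): G-F2∕G-F3 `B9Cor36GCubeLocLetter` (`locLetterBY`, `conjY_mul_conjY_inv_eq_one` USED), def-Y
`Node00.OpsYOfLetters` (`cdB`, `cdsB`, `lapB`), `B9CoReadingCoords` (`cdBₗ`, `cdsBₗ`, `lapBₗ`), `B9Eq3104CutoffCommutators` (`hBdY`, `cdB_cutMulY_apply`),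
`B9Thm310CutoffLapTermsB` (`cdB_apply_eq`, `lapB_cutMulY_apply`), `B9Thm310CommutatorDataOfPlaquettes.UboxY_chartY` (USED), `B9Thm310CutoffDivTermsB.cutMulY_cdsB_eq` (the unshifted backward Leibniz rule; here the
SHIFTED form `cutMul_cdsB_shift` is used, as in 7b-D2), `B9CubeLettersInvReadings` (`cdB_conj` …), `B9CubeLettersInvWriteDictB` (the writer), G-F6a, G-F6b-T,
p33's 7b-D1 `B9Cor36CutoffSecondDiff`.
-/

noncomputable section

namespace Literature.MathematicalPhysics.QuantumFieldTheory.Balaban1983to89.B9Cor36GCubeLocAtMember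

open B4PartitionUnity22 (thetaProf D1 D2 D1_nonneg D2_nonneg contDiff_thetaProf hasCompactSupport_thetaProf)
open B6RandomWalk (HasMajorant hasMajorant_mono hasMajorant_add)
open B9Thm34Ext (toB6)
open B9Ineq347 (ScaleTransfer)
open B9Eq39Adjoint (R R_zero R_smul R_add R_sub R_neg R_inv_R R_R_inv covD fluct)
open B9Eq352DivFormLetters (conj conj_sub conj_neg)
open B9Eq352GradLetters (conj_add conj_finset_sum)
open B6KLevelCensusIndexV1 (KIdx kGeo)
open B6Cover236MultiLevelBlocks (cubes)
open B6GlobalChartV1 (PV boxEquiv blkV1)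
open B9BackgroundsKLevelV1 (shiftsV1)
open B6Geom246MultiLevelBox (blkOf)
open B6Ineq2142KLevelV1 (β)
open B9GeoNormsKLevelV1 (geo9K geo9K_dist_nonneg)
open B9FromB6 (EBlock)
open B9Eq360DeltaPrimeAY (AfldY)
open B9Eq360DeltaPrimeACubeY (blkCubeY)
open B9CubeLettersBondOpsL0 (BlkCubeY deltaACubeY GACubeY)
open B9CubeGeometryInputs (geoCK geoCK_len_pos RM1 N1 hST_geoCK)
open B9CubeSequence408 (NearH)
open B9CubeLettersInvReadings (kernelFamilyBInv cdB_conj cdsB_conj lapB_conj)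
open B9CubeLettersInvWriteDictB (eBlock_kernelFamilyBInv_of_hasMajorant)
open B9Thm37CubeCoverCommutators (cutMulY cutMulY_apply)
open B9Eq3104CutoffCommutators (hBdY hBdY_apply cdB_cutMulY_apply cdsB_cutMulY_apply)
open B9Thm310CutoffLapTermsB (cdB_apply_eq cdsB_apply_eq lapB_cutMulY_apply)
open B9Thm310CommutatorDataOfPlaquettes (UboxY_chartY)
open B9Cor35GpCubeInputsAtOne (hasMajorant_neg)
open B9Cor35GCubeInputsAtOne (blkBK GVK)
open B9Cor36CubeCutoffs (SC NearC chiY locCfgY nearC_of_chiY_ne_zero abs_chiY_le_one)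
open B9Cor36GCubeLocLetter (locLetterBY conjY_mul_conjY_inv_eq_one)
open B9Cor36BondSandwichTransfer (hasMajorant_conj_bond_sandwich_decay hasMajorant_conj_bond_sandwich_decay_src)
open B9Cor36GCubeEntriesAtV (cor36_G_cube_entries_at_locCfg')
open B9Cor36GCubeWindows (sRead)
open B9Cor36GpCubeLocAtMember (agree_near nearC_of_chiY_ne_zero₃ hasMajorant_congr_op hasMajorant_finset_sum kernel_le)
open B9Cor36CutoffSecondDiff (chiY_weights nearH_of_chiY_ne_zero₃)
open B9CoReadingCoords (cdBₗ cdsBₗ lapBₗ cdBₗ_apply cdsBₗ_apply lapBₗ_apply)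
open B9Ineq373HessianPieceBoundsY (abs_cf_eq)
open Node00 (SiteY BlkY IBondY FBondY CfgY GaugeY BondParY toKT shiftY gaugeY gBondY parSymY parBY UboxY conjY conjY_apply cdB cdsB lapB)
open Node00.OpsYNablaBridge (chartY shiftY_chartY shiftY_symm_chartY shift_unshift unshift_shift)

variable {d ℓ : ℕ} {hd : 1 ≤ d + 1} {hL : Odd (ℓ + 1) ∧ 1 < ℓ + 1} {b₀ b₁ : ℝ}
variable {𝔸 : Type} [NormedRing 𝔸] [NormedAlgebra ℂ 𝔸] [CompleteSpace 𝔸]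
variable {ι : Type} [Fintype ι]

/-! ## §1  Pointwise, bond sector: (3.31) through `R(u)⁻¹` with the bond variable read localised to `Ṽ_□`; `R(U)⁻¹∇_U(· − e_μ) = −∇*_U` -/

section Pointwise

variable (i : KIdx d ℓ hd hL b₀ b₁)

omit [CompleteSpace 𝔸] in
/-- `R(γ)R(γ)⁻¹Ψ = Ψ` on any carrier (G-F3's `conjY_mul_conjY_inv_eq_one`, applied). [cite: Balaban1985BackgroundPropagators, (3.28) p.395, bookkeeping] -/
theorem conjY_conjY_inv {X : Type} (γ : X → 𝔸ˣ) (Ψ : X → 𝔸) : conjY γ (conjY γ⁻¹ Ψ) = Ψ := by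
  rw [← Module.End.mul_apply, conjY_mul_conjY_inv_eq_one, Module.End.one_apply]

omit [CompleteSpace 𝔸] in
/-- `(R(γ)⁻¹Ψ)(f) = R(γ(f))⁻¹Ψ(f)`. [cite: Balaban1985BackgroundPropagators, (3.28) p.395, bookkeeping] -/
theorem conjY_inv_apply' {X : Type} (γ : X → 𝔸ˣ) (Ψ : X → 𝔸) (z : X) : conjY γ⁻¹ Ψ z = R (γ z)⁻¹ (Ψ z) := by
  rw [conjY_apply, Pi.inv_apply]

/-- `(∇_{U,μ}Ψ)(f)` depends on `U` only through the bond variable `U_μ(f₋)`. [cite: Balaban1985BackgroundPropagators, (3.3) p.390, p.410 l.14–15] -/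
theorem cdB_congr_pt {W V : CfgY 𝔸 i} {μ : Fin (d + 1)} {f : FBondY i} (h : W μ f.src = V μ f.src) (Ψ : FBondY i → 𝔸) :
    cdB i W μ Ψ f = cdB i V μ Ψ f := by
  rw [cdB_apply_eq, cdB_apply_eq, h]

/-- `(∇*_{U,μ}Ψ)(f)` depends on `U` only through `U_μ(f₋ − e_μ)`. [cite: Balaban1985BackgroundPropagators, (3.8) p.392, p.410 l.14–15] -/
theorem cdsB_congr_pt {W V : CfgY 𝔸 i} {μ : Fin (d + 1)} {f : FBondY i} (h : W μ (f.src.unshift μ) = V μ (f.src.unshift μ))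
    (Ψ : FBondY i → 𝔸) : cdsB i W μ Ψ f = cdsB i V μ Ψ f := by
  rw [cdsB_apply_eq, cdsB_apply_eq, h]

/-- `(Δ_UΨ)(f)` depends on `U` only through `U_ν(f₋)`, `U_ν(f₋ − e_ν)`, all `ν`. [cite: Balaban1985BackgroundPropagators, (3.23) p.394, p.410 l.14–15] -/
theorem lapB_congr_pt {W V : CfgY 𝔸 i} {f : FBondY i}
    (h : ∀ ν, W ν f.src = V ν f.src ∧ W ν (f.src.unshift ν) = V ν (f.src.unshift ν)) (Ψ : FBondY i → 𝔸) :
    lapB i W Ψ f = lapB i V Ψ f := by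
  have h1 : ∀ ν, W ν f.src = V ν f.src := fun ν => (h ν).1
  have h2 : ∀ ν, W ν (f.src.unshift ν) = V ν (f.src.unshift ν) := fun ν => (h ν).2
  show (∑ ν, cdsB i W ν (cdB i W ν Ψ) f) = ∑ ν, cdsB i V ν (cdB i V ν Ψ) f
  simp only [cdsB_apply_eq, cdB_apply_eq, h1, h2]

/-- ★ **FORWARD TRANSPORT-AND-LOCALISE, BOND SECTOR**: where `U^u_μ(f₋) = Ṽ_μ(f₋)`, `(∇_{U,μ}R(u)⁻¹Ψ)(f) = R(u(f₋))⁻¹(∇_{Ṽ,μ}Ψ)(f)` ((3.31) on bond functions: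
`∇_{U^u}R(u) = R(u)∇_U`, readings' `cdB_conj`). [cite: Balaban1985BackgroundPropagators, (3.31) p.395, (3.28) p.395 («(R(u)U′)(x,x′) = R(u(x))U′(x,x′)»), Cor. 3.6 p.408 («gauge invariant»), p.410 l.14–15] -/
theorem transport_fwd (u : GaugeY 𝔸 i) (U V : CfgY 𝔸 i) {μ : Fin (d + 1)} {f : FBondY i} (hz : gaugeY i u U μ f.src = V μ f.src)
    (Ψ : FBondY i → 𝔸) : cdB i U μ (conjY (gBondY i u)⁻¹ Ψ) f = R (gBondY i u f)⁻¹ (cdB i V μ Ψ f) := by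
  have hc := congrFun (cdB_conj i u U μ (conjY (gBondY i u)⁻¹ Ψ)) f
  rw [conjY_conjY_inv, conjY_apply, cdB_congr_pt i hz] at hc
  rw [hc, R_inv_R]

/-- ★ **BACKWARD TRANSPORT-AND-LOCALISE, BOND SECTOR**: where `U^u_μ(f₋ − e_μ) = Ṽ_μ(f₋ − e_μ)`, `(∇*_{U,μ}R(u)⁻¹Ψ)(f) = R(u(f₋))⁻¹(∇*_{Ṽ,μ}Ψ)(f)`.
[cite: Balaban1985BackgroundPropagators, (3.31) p.395, (3.8) p.392, p.410 l.14–15] -/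
theorem transport_bwd (u : GaugeY 𝔸 i) (U V : CfgY 𝔸 i) {μ : Fin (d + 1)} {f : FBondY i}
    (hz : gaugeY i u U μ (f.src.unshift μ) = V μ (f.src.unshift μ)) (Ψ : FBondY i → 𝔸) :
    cdsB i U μ (conjY (gBondY i u)⁻¹ Ψ) f = R (gBondY i u f)⁻¹ (cdsB i V μ Ψ f) := by
  have hc := congrFun (cdsB_conj i u U μ (conjY (gBondY i u)⁻¹ Ψ)) f
  rw [conjY_conjY_inv, conjY_apply, cdsB_congr_pt i hz] at hc
  rw [hc, R_inv_R]

/-- ★ **LAPLACIAN TRANSPORT-AND-LOCALISE, BOND SECTOR**: where `U^u` and `Ṽ` agree on the bond variables `(ν, f₋)`, `(ν, f₋ − e_ν)` (all `ν`),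
`(Δ_U R(u)⁻¹Ψ)(f) = R(u(f₋))⁻¹(Δ_{Ṽ}Ψ)(f)` ((3.31): `Δ_{U^u}R(u) = R(u)Δ_U`, readings' `lapB_conj`). [cite: Balaban1985BackgroundPropagators, (3.31) p.395, (3.23) p.394, p.410 l.14–15] -/
theorem transport_lap (u : GaugeY 𝔸 i) (U V : CfgY 𝔸 i) {f : FBondY i}
    (hz : ∀ ν, gaugeY i u U ν f.src = V ν f.src ∧ gaugeY i u U ν (f.src.unshift ν) = V ν (f.src.unshift ν)) (Ψ : FBondY i → 𝔸) :
    lapB i U (conjY (gBondY i u)⁻¹ Ψ) f = R (gBondY i u f)⁻¹ (lapB i V Ψ f) := by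
  have hc := congrFun (lapB_conj i u U (conjY (gBondY i u)⁻¹ Ψ)) f
  rw [conjY_conjY_inv, conjY_apply, lapB_congr_pt i hz] at hc
  rw [hc, R_inv_R]

/-- the forward transport in the shape of the Leibniz remainder: `c_f•R(U_μ(f₋))(R(u)⁻¹Ψ)(f + e_μ) = R(u(f₋))⁻¹(∇_{Ṽ,μ}Ψ)(f) + c_f•R(u(f₋))⁻¹Ψ(f)`.
[cite: Balaban1985BackgroundPropagators, (3.31) p.395, (3.3) p.390, (3.100) p.413] -/
theorem transport_fwd' (u : GaugeY 𝔸 i) (U V : CfgY 𝔸 i) {μ : Fin (d + 1)} {f : FBondY i} (hz : gaugeY i u U μ f.src = V μ f.src)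
    (Ψ : FBondY i → 𝔸) :
    ((i.cf : ℝ) : ℂ) • R (U μ f.src) (conjY (gBondY i u)⁻¹ Ψ ⟨f.src.shift μ, f.dir⟩) =
      R (gBondY i u f)⁻¹ (cdB i V μ Ψ f) + ((i.cf : ℝ) : ℂ) • R (gBondY i u f)⁻¹ (Ψ f) := by
  have h := transport_fwd i u U V hz Ψ
  rw [cdB_apply_eq, smul_sub, sub_eq_iff_eq_add, conjY_inv_apply' (gBondY i u) Ψ f] at h
  exact h

/-- ★ **`R(U_μ(f₋ − e_μ))⁻¹(∇_{U,μ}A)(f − e_μ) = −(∇*_{U,μ}A)(f)`** (`R(W)⁻¹·c_f(R(W)A(f) − A(f − e_μ)) = −c_f(R(W)⁻¹A(f − e_μ) − A(f))`): the backward term of the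
Laplacian's Leibniz rule (`lapB_cutMulY_apply`) IS the backward covariant derivative. [cite: Balaban1985BackgroundPropagators, (3.3) p.390, (3.8) p.392, (3.100) p.413] -/
theorem Rinv_cdB_unshift_eq_neg_cdsB (U : CfgY 𝔸 i) (μ : Fin (d + 1)) (A : FBondY i → 𝔸) (f : FBondY i) :
    R (U μ (f.src.unshift μ))⁻¹ (cdB i U μ A ⟨f.src.unshift μ, f.dir⟩) = -cdsB i U μ A f := by
  have eb : (⟨f.src, f.dir⟩ : FBondY i) = f := rfl
  simp only [cdB_apply_eq, cdsB_apply_eq, shift_unshift, R_smul, R_sub, R_inv_R, eb]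
  rw [← smul_neg, neg_sub]

/-- the backward Leibniz rule in the shifted form, bond sector: `χ(f₋)(∇*_{U,μ}Λ)(f) = (∇*_{U,μ}(χ⁺Λ))(f) + c_f(χ(f₋ + e_μ) − χ(f₋))Λ(f)`, `χ⁺ = χ(· + e_μ)`
read at `b₋` — a pure multiplier remainder. [cite: Balaban1985BackgroundPropagators, (3.100) p.413 («similarly for adjoint derivatives»), (3.8) p.392] -/
theorem cutMul_cdsB_shift (U : CfgY 𝔸 i) (μ : Fin (d + 1)) (χ : SiteY i → ℝ) (Λ : FBondY i → 𝔸) (f : FBondY i) :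
    ((χ (chartY i f.src) : ℝ) : ℂ) • cdsB i U μ Λ f
      = cdsB i U μ (cutMulY (hBdY i (fun v => χ (shiftY i μ v))) Λ) f
        + ((i.cf * (χ (shiftY i μ (chartY i f.src)) - χ (chartY i f.src)) : ℝ) : ℂ) • Λ f := by
  simp only [cdsB_apply_eq, cutMulY_apply, hBdY_apply, shiftY_chartY, shift_unshift, R_smul, smul_sub, smul_smul]
  push_cast
  module

/-- ★ **BACKWARD TRANSPORT ON THE RIGHT, BOND SECTOR**: `R(u)∇*_{U,μ}(hΛ) = ∇*_{Ṽ,μ}(R(u)hΛ)` as functions, when `U^u_μ(f₋ − e_μ) = Ṽ_μ(f₋ − e_μ)` wherever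
`h(f − e_μ) ≠ 0` (elsewhere the transported term vanishes). [cite: Balaban1985BackgroundPropagators, (3.31) p.395, (3.8) p.392, p.410 l.14–15] -/
theorem transport_bwd_right (u : GaugeY 𝔸 i) (U V : CfgY 𝔸 i) (μ : Fin (d + 1)) (h : FBondY i → ℝ)
    (hh : ∀ f : FBondY i, h ⟨f.src.unshift μ, f.dir⟩ ≠ 0 → gaugeY i u U μ (f.src.unshift μ) = V μ (f.src.unshift μ)) (Λ : FBondY i → 𝔸) :
    conjY (gBondY i u) (cdsB i U μ (cutMulY h Λ)) = cdsB i V μ (conjY (gBondY i u) (cutMulY h Λ)) := by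
  rw [← cdsB_conj]
  funext f
  by_cases hw : h ⟨f.src.unshift μ, f.dir⟩ = 0
  · rw [cdsB_apply_eq, cdsB_apply_eq]
    simp only [conjY_apply, cutMulY_apply, hw, Complex.ofReal_zero, zero_smul, R_zero]
  · exact cdsB_congr_pt i (hh f hw) _

end Pointwise

/-! ## §2  The letters in `End_ℝ` and the three identities (Leibniz (3.100), covariance (3.31), localisation `U^u = Ṽ_□` near `supp χ_□`) -/

section Letters

variable (i : KIdx d ℓ hd hL b₀ b₁) (c : ↥(cubes (toKT i).D.toDomains))

/-- **THE BOND-SECTOR SANDWICH `M_{g₁}R(γ)⁻¹·M·R(γ)M_{g₂}`** in `End_ℝ` (G-F6b-T's shape, verbatim). [cite: Balaban1985BackgroundPropagators, (3.87) p.409, Cor. 3.6 p.408, dictionary] -/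
abbrev SandB (γ : FBondY i → 𝔸ˣ) (g₁ : FBondY i → ℝ) (M : Module.End ℝ (FBondY i → 𝔸)) (g₂ : FBondY i → ℝ) : Module.End ℝ (FBondY i → 𝔸) :=
  (cutMulY (𝔸 := 𝔸) g₁).restrictScalars ℝ ∘ₗ (conjY γ⁻¹).restrictScalars ℝ ∘ₗ M ∘ₗ (conjY γ).restrictScalars ℝ ∘ₗ
    (cutMulY (𝔸 := 𝔸) g₂).restrictScalars ℝ

omit [CompleteSpace 𝔸] in
/-- the sandwich applied: `(Sand(g₁, M, g₂)Λ)(f) = g₁(f)•R(γ(f))⁻¹(M(R(γ)(g₂Λ)))(f)`. [cite: Balaban1985BackgroundPropagators, (3.87) p.409, bookkeeping] -/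
theorem sandB_apply (γ : FBondY i → 𝔸ˣ) (g₁ : FBondY i → ℝ) (M : Module.End ℝ (FBondY i → 𝔸)) (g₂ : FBondY i → ℝ) (Λ : FBondY i → 𝔸)
    (f : FBondY i) : SandB i γ g₁ M g₂ Λ f = ((g₁ f : ℝ) : ℂ) • R (γ f)⁻¹ (M (conjY γ (cutMulY g₂ Λ)) f) := by
  simp only [SandB, LinearMap.comp_apply, LinearMap.restrictScalars_apply, cutMulY_apply, conjY_apply, Pi.inv_apply]

/-- **`G_□(Ṽ_□)` IN `End_ℝ`** (so that `conj b (GinB i □ A) = GVK b i □ parSymY parBY Ṽ_□` by `rfl`): r05's `GACubeY` = `Δ_{a,□}⁻¹` read at the localised field.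
[cite: Balaban1985BackgroundPropagators, p.409 l.1–5 («G_□(U)»), Thm 3.4 p.400, Cor. 3.6 p.408] -/
def GinB (A : AfldY 𝔸 i) : Module.End ℝ (FBondY i → 𝔸) :=
  (GACubeY i c (parSymY i) (parBY i) (locCfgY i c (kGeo i).eta A)).restrictScalars ℝ

/-- `conj b(G_□(Ṽ_□)) = GVK` (G-F4's letter). [cite: Balaban1985BackgroundPropagators, p.409 l.1–5, bookkeeping] -/
theorem conj_GinB (b : Module.Basis ι ℝ 𝔸) (A : AfldY 𝔸 i) : conj b (GinB i c A) = GVK b i c (parSymY i) (parBY i) (locCfgY i c (kGeo i).eta A) := rfl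

/-- `GinB` applied. [cite: Balaban1985BackgroundPropagators, p.409 l.1–5, bookkeeping] -/
theorem GinB_apply (A : AfldY 𝔸 i) (Φ : FBondY i → 𝔸) : GinB i c A Φ = GACubeY i c (parSymY i) (parBY i) (locCfgY i c (kGeo i).eta A) Φ := rfl

/-- **`O_□` IN `End_ℝ`**: G-F2∕G-F3's localised, transported, cut-off cube letter `locLetterBY i □ parSymY parBY u χ_□ Ṽ_□ = M_χ R(u)⁻¹ G_□(Ṽ_□) R(u) M_χ` with `u`
read at `b₋` (`gBondY`) and `χ_□` read at `b₋` (`hBdY`). [cite: Balaban1985BackgroundPropagators, Cor. 3.6 p.408, (3.87) p.409, p.409 l.1–5] -/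
def GmemB (u : GaugeY 𝔸 i) (A : AfldY 𝔸 i) : Module.End ℝ (FBondY i → 𝔸) :=
  SandB i (gBondY i u) (hBdY i (chiY i c)) (GinB i c A) (hBdY i (chiY i c))

/-- ★ `GmemB = O_□` (the writer's binder `hG`). [cite: Balaban1985BackgroundPropagators, Cor. 3.6 p.408, (3.87) p.409] -/
theorem GmemB_apply (u : GaugeY 𝔸 i) (A : AfldY 𝔸 i) (Λ : FBondY i → 𝔸) :
    GmemB i c u A Λ = locLetterBY i c (parSymY i) (parBY i) u (chiY i c) (locCfgY i c (kGeo i).eta A) Λ := rfl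

/-- `GmemB` applied, as a cut-off of a rotated function. [cite: Balaban1985BackgroundPropagators, (3.87) p.409, bookkeeping] -/
theorem GmemB_apply_fun (u : GaugeY 𝔸 i) (A : AfldY 𝔸 i) (Λ : FBondY i → 𝔸) :
    GmemB i c u A Λ = cutMulY (hBdY i (chiY i c)) (conjY (gBondY i u)⁻¹ (GinB i c A (conjY (gBondY i u) (cutMulY (hBdY i (chiY i c)) Λ)))) := rfl

variable {i c} in
/-- the agreement binder at a torus site: `U^u = Ṽ_□` on the bond variables `(μ, x)` and `(μ, x − e_μ)`. [cite: Balaban1985BackgroundPropagators, Cor. 3.6 p.408, p.410 l.14–15, bookkeeping] -/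
theorem agree_src {u : GaugeY 𝔸 i} {U V : CfgY 𝔸 i} {N : SiteY i → Prop}
    (hAG : ∀ (μ : Fin (d + 1)) (w : SiteY i), N w → UboxY i (gaugeY i u U) μ w = UboxY i V μ w ∧
      UboxY i (gaugeY i u U) μ ((shiftY i μ).symm w) = UboxY i V μ ((shiftY i μ).symm w))
    (μ : Fin (d + 1)) (x : Site (PV d ℓ i.m i.K hd hL) 0) (hx : N (chartY i x)) :
    gaugeY i u U μ x = V μ x ∧ gaugeY i u U μ (x.unshift μ) = V μ (x.unshift μ) := by
  obtain ⟨h1, h2⟩ := hAG μ (chartY i x) hx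
  rw [UboxY_chartY, UboxY_chartY] at h1
  rw [shiftY_symm_chartY, UboxY_chartY, UboxY_chartY] at h2
  exact ⟨h1, h2⟩

variable (u : GaugeY 𝔸 i) (U : CfgY 𝔸 i) (A : AfldY 𝔸 i)

/-- ★★ **THE `∇`-ENTRY IDENTITY**: `∇_{U,μ}·O_□ = Sand(χ⁺, ∇_{Ṽ,μ}G_□, χ) + Sand(c_f∂⁺_μχ, G_□, χ)`, `χ⁺ = χ_□(· + e_μ)`, `∂⁺_μχ = χ⁺ − χ_□` (read at `b₋`) — Leibniz
(3.100), covariance (3.31), and `U^u = Ṽ_□` on the bond variables at the points of `N ⊇ {χ_□ ≠ 0 at z, z ± e_μ}`.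
[cite: Balaban1985BackgroundPropagators, (3.100) p.413, (3.31) p.395, Cor. 3.6 p.408, p.410 l.14–15] -/
theorem cdBₗ_mul_GmemB {N : SiteY i → Prop}
    (hN : ∀ (μ : Fin (d + 1)) (z : SiteY i), (chiY i c z ≠ 0 ∨ chiY i c (shiftY i μ z) ≠ 0 ∨ chiY i c ((shiftY i μ).symm z) ≠ 0) → N z)
    (hAG : ∀ (μ : Fin (d + 1)) (w : SiteY i), N w →
      UboxY i (gaugeY i u U) μ w = UboxY i (locCfgY i c (kGeo i).eta A) μ w ∧
      UboxY i (gaugeY i u U) μ ((shiftY i μ).symm w) = UboxY i (locCfgY i c (kGeo i).eta A) μ ((shiftY i μ).symm w))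
    (μ : Fin (d + 1)) :
    cdBₗ i U μ * GmemB i c u A
      = SandB i (gBondY i u) (hBdY i (fun z => chiY i c (shiftY i μ z))) (cdBₗ i (locCfgY i c (kGeo i).eta A) μ * GinB i c A) (hBdY i (chiY i c))
        + SandB i (gBondY i u) (hBdY i (fun z => i.cf * (chiY i c (shiftY i μ z) - chiY i c z))) (GinB i c A) (hBdY i (chiY i c)) := by
  refine LinearMap.ext fun Λ => funext fun f => ?_
  set Ψ : FBondY i → 𝔸 := GinB i c A (conjY (gBondY i u) (cutMulY (hBdY i (chiY i c)) Λ)) with hΨ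
  rw [Module.End.mul_apply, GmemB_apply_fun, cdBₗ_apply, LinearMap.add_apply, Pi.add_apply, sandB_apply, sandB_apply, Module.End.mul_apply,
    cdBₗ_apply, cdB_cutMulY_apply]
  simp only [hBdY_apply, ← shiftY_chartY]
  by_cases h0 : chiY i c (chartY i f.src) = 0 ∧ chiY i c (shiftY i μ (chartY i f.src)) = 0
  · rw [h0.1, h0.2]; simp
  · have hor : chiY i c (chartY i f.src) ≠ 0 ∨ chiY i c (shiftY i μ (chartY i f.src)) ≠ 0 ∨
        chiY i c ((shiftY i μ).symm (chartY i f.src)) ≠ 0 := by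
      rcases not_and_or.mp h0 with h | h
      · exact Or.inl h
      · exact Or.inr (Or.inl h)
    have hz := (agree_src hAG μ f.src (hN μ _ hor)).1
    have h2 := transport_fwd' i u U _ hz Ψ
    have e : (((i.cf * (chiY i c (shiftY i μ (chartY i f.src)) - chiY i c (chartY i f.src)) : ℝ)) : ℂ) •
          R (U μ f.src) (conjY (gBondY i u)⁻¹ Ψ ⟨f.src.shift μ, f.dir⟩)
        = (((chiY i c (shiftY i μ (chartY i f.src)) - chiY i c (chartY i f.src) : ℝ)) : ℂ) •
            (((i.cf : ℝ) : ℂ) • R (U μ f.src) (conjY (gBondY i u)⁻¹ Ψ ⟨f.src.shift μ, f.dir⟩)) := by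
      rw [smul_smul, ← Complex.ofReal_mul, mul_comm]
    rw [transport_fwd i u U _ hz Ψ, e, h2]
    push_cast
    module

/-- ★★ **THE `∇*`-ENTRY IDENTITY**: `O_□·∇*_{U,μ} = Sand(χ, G_□∇*_{Ṽ,μ}, χ⁺) + Sand(χ, G_□, c_f∂⁺_μχ)` — the shifted backward Leibniz rule `χ∇* = ∇*χ⁺ + c_f∂⁺χ`,
covariance (3.31) on the right, and `U^u = Ṽ_□` on the bond variables `(μ, f₋ − e_μ)` for `χ(f₋) ≠ 0`.
[cite: Balaban1985BackgroundPropagators, (3.100) p.413, (3.8) p.392, (3.31) p.395, Cor. 3.6 p.408, p.410 l.14–15] -/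
theorem GmemB_mul_cdsBₗ {N : SiteY i → Prop}
    (hN : ∀ (μ : Fin (d + 1)) (z : SiteY i), (chiY i c z ≠ 0 ∨ chiY i c (shiftY i μ z) ≠ 0 ∨ chiY i c ((shiftY i μ).symm z) ≠ 0) → N z)
    (hAG : ∀ (μ : Fin (d + 1)) (w : SiteY i), N w →
      UboxY i (gaugeY i u U) μ w = UboxY i (locCfgY i c (kGeo i).eta A) μ w ∧
      UboxY i (gaugeY i u U) μ ((shiftY i μ).symm w) = UboxY i (locCfgY i c (kGeo i).eta A) μ ((shiftY i μ).symm w))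
    (μ : Fin (d + 1)) :
    GmemB i c u A * cdsBₗ i U μ
      = SandB i (gBondY i u) (hBdY i (chiY i c)) (GinB i c A * cdsBₗ i (locCfgY i c (kGeo i).eta A) μ) (hBdY i (fun z => chiY i c (shiftY i μ z)))
        + SandB i (gBondY i u) (hBdY i (chiY i c)) (GinB i c A) (hBdY i (fun z => i.cf * (chiY i c (shiftY i μ z) - chiY i c z))) := by
  -- the function identity `R(u)(χ∇*_UΛ) = ∇*_{Ṽ}(R(u)χ⁺Λ) + R(u)(c_f∂⁺χ·Λ)`
  have FI : ∀ Λ : FBondY i → 𝔸, conjY (gBondY i u) (cutMulY (hBdY i (chiY i c)) (cdsB i U μ Λ))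
      = cdsB i (locCfgY i c (kGeo i).eta A) μ (conjY (gBondY i u) (cutMulY (hBdY i (fun v => chiY i c (shiftY i μ v))) Λ))
        + conjY (gBondY i u) (cutMulY (hBdY i (fun v => i.cf * (chiY i c (shiftY i μ v) - chiY i c v))) Λ) := by
    intro Λ
    have hR := transport_bwd_right i u U (locCfgY i c (kGeo i).eta A) μ (hBdY i (fun v => chiY i c (shiftY i μ v))) (fun f hf => ?_) Λ
    · funext f
      rw [Pi.add_apply, ← hR, conjY_apply, cutMulY_apply, hBdY_apply, cutMul_cdsB_shift, R_add, R_smul, conjY_apply, conjY_apply, cutMulY_apply,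
        hBdY_apply, R_smul]
    · have hf' : chiY i c (chartY i f.src) ≠ 0 := by
        rwa [hBdY_apply, shiftY_chartY, shift_unshift] at hf
      exact (agree_src hAG μ f.src (hN μ _ (Or.inl hf'))).2
  refine LinearMap.ext fun Λ => funext fun f => ?_
  rw [Module.End.mul_apply, cdsBₗ_apply, GmemB_apply_fun, FI, map_add, LinearMap.add_apply, Pi.add_apply, sandB_apply, sandB_apply,
    Module.End.mul_apply, cdsBₗ_apply, cutMulY_apply, hBdY_apply, conjY_inv_apply', Pi.add_apply, R_add, smul_add]

/-- ★★ **THE LAPLACIAN-ENTRY IDENTITY**: `Δ_U·O_□ = Sand(χ, Δ_{Ṽ}G_□, χ) − Σ_μ [Sand(c_f∂⁻_μχ, ∇*_{Ṽ,μ}G_□, χ) + Sand(c_f∂⁺_μχ, ∇_{Ṽ,μ}G_□, χ)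
+ Sand(c_f²∂_μ∂*_μχ, G_□, χ)]`, `∂⁻_μχ = χ(· − e_μ) − χ`, `∂_μ∂*_μχ = χ(· + e_μ) − 2χ + χ(· − e_μ)` — the (3.88) first line on the bond sector
(`lapB_cutMulY_apply` + `R(U)⁻¹∇_U(· − e_μ) = −∇*_U`), covariance (3.31) for `∇`, `∇*`, `Δ`, and the agreement on the bond variables at `f₋`, `f₋ − e_μ`.
[cite: Balaban1985BackgroundPropagators, (3.88)–(3.89) p.409, (3.100) p.413, (3.31) p.395, p.410 l.14–15; Balaban1984PropagatorsII, (2.39)–(2.44) pp.229–230] -/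
theorem lapBₗ_mul_GmemB {N : SiteY i → Prop}
    (hN : ∀ (μ : Fin (d + 1)) (z : SiteY i), (chiY i c z ≠ 0 ∨ chiY i c (shiftY i μ z) ≠ 0 ∨ chiY i c ((shiftY i μ).symm z) ≠ 0) → N z)
    (hAG : ∀ (μ : Fin (d + 1)) (w : SiteY i), N w →
      UboxY i (gaugeY i u U) μ w = UboxY i (locCfgY i c (kGeo i).eta A) μ w ∧
      UboxY i (gaugeY i u U) μ ((shiftY i μ).symm w) = UboxY i (locCfgY i c (kGeo i).eta A) μ ((shiftY i μ).symm w)) :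
    lapBₗ i U * GmemB i c u A
      = SandB i (gBondY i u) (hBdY i (chiY i c)) (lapBₗ i (locCfgY i c (kGeo i).eta A) * GinB i c A) (hBdY i (chiY i c))
        - ∑ μ : Fin (d + 1),
          (SandB i (gBondY i u) (hBdY i (fun z => i.cf * (chiY i c ((shiftY i μ).symm z) - chiY i c z)))
              (cdsBₗ i (locCfgY i c (kGeo i).eta A) μ * GinB i c A) (hBdY i (chiY i c))
            + SandB i (gBondY i u) (hBdY i (fun z => i.cf * (chiY i c (shiftY i μ z) - chiY i c z)))
              (cdBₗ i (locCfgY i c (kGeo i).eta A) μ * GinB i c A) (hBdY i (chiY i c))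
            + SandB i (gBondY i u) (hBdY i (fun z => i.cf ^ 2 * (chiY i c (shiftY i μ z) - 2 * chiY i c z + chiY i c ((shiftY i μ).symm z))))
              (GinB i c A) (hBdY i (chiY i c))) := by
  refine LinearMap.ext fun Λ => funext fun f => ?_
  rw [Module.End.mul_apply, GmemB_apply_fun, lapBₗ_apply, lapB_cutMulY_apply, LinearMap.sub_apply, Pi.sub_apply, sandB_apply, Module.End.mul_apply,
    lapBₗ_apply, LinearMap.sum_apply, Finset.sum_apply]
  simp only [LinearMap.add_apply, Pi.add_apply, sandB_apply, Module.End.mul_apply, cdBₗ_apply, cdsBₗ_apply, hBdY_apply, ← shiftY_chartY,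
    ← shiftY_symm_chartY]
  generalize GinB i c A (conjY (gBondY i u) (cutMulY (hBdY i (chiY i c)) Λ)) = Ψ
  rw [sub_eq_add_neg, ← Finset.sum_neg_distrib]
  congr 1
  · -- the main term `χ(f₋)(Δ_U R(u)⁻¹Ψ)(f) = χ(f₋)R(u(f₋))⁻¹(Δ_{Ṽ}Ψ)(f)`
    by_cases h0 : chiY i c (chartY i f.src) = 0
    · simp only [h0, Complex.ofReal_zero, zero_smul]
    · rw [transport_lap i u U _ (fun ν => agree_src hAG ν f.src (hN ν _ (Or.inl h0))) Ψ]
  · refine Finset.sum_congr rfl fun μ _ => ?_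
    rw [Rinv_cdB_unshift_eq_neg_cdsB, conjY_inv_apply' (gBondY i u) Ψ f]
    -- backward piece
    have hA : (((i.cf * (chiY i c ((shiftY i μ).symm (chartY i f.src)) - chiY i c (chartY i f.src)) : ℝ)) : ℂ) •
          cdsB i U μ (conjY (gBondY i u)⁻¹ Ψ) f
        = (((i.cf * (chiY i c ((shiftY i μ).symm (chartY i f.src)) - chiY i c (chartY i f.src)) : ℝ)) : ℂ) •
            R (gBondY i u f)⁻¹ (cdsB i (locCfgY i c (kGeo i).eta A) μ Ψ f) := by
      by_cases h1 : chiY i c (chartY i f.src) = 0 ∧ chiY i c ((shiftY i μ).symm (chartY i f.src)) = 0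
      · rw [h1.1, h1.2, sub_self, mul_zero, Complex.ofReal_zero, zero_smul, zero_smul]
      · have hor : chiY i c (chartY i f.src) ≠ 0 ∨ chiY i c (shiftY i μ (chartY i f.src)) ≠ 0 ∨
            chiY i c ((shiftY i μ).symm (chartY i f.src)) ≠ 0 := by
          rcases not_and_or.mp h1 with h | h
          · exact Or.inl h
          · exact Or.inr (Or.inr h)
        rw [transport_bwd i u U _ (agree_src hAG μ f.src (hN μ _ hor)).2 Ψ]
    -- forward piece
    have hB : (((i.cf * (chiY i c (shiftY i μ (chartY i f.src)) - chiY i c (chartY i f.src)) : ℝ)) : ℂ) •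
          cdB i U μ (conjY (gBondY i u)⁻¹ Ψ) f
        = (((i.cf * (chiY i c (shiftY i μ (chartY i f.src)) - chiY i c (chartY i f.src)) : ℝ)) : ℂ) •
            R (gBondY i u f)⁻¹ (cdB i (locCfgY i c (kGeo i).eta A) μ Ψ f) := by
      by_cases h1 : chiY i c (chartY i f.src) = 0 ∧ chiY i c (shiftY i μ (chartY i f.src)) = 0
      · rw [h1.1, h1.2, sub_self, mul_zero, Complex.ofReal_zero, zero_smul, zero_smul]
      · have hor : chiY i c (chartY i f.src) ≠ 0 ∨ chiY i c (shiftY i μ (chartY i f.src)) ≠ 0 ∨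
            chiY i c ((shiftY i μ).symm (chartY i f.src)) ≠ 0 := by
          rcases not_and_or.mp h1 with h | h
          · exact Or.inl h
          · exact Or.inr (Or.inl h)
        rw [transport_fwd i u U _ (agree_src hAG μ f.src (hN μ _ hor)).1 Ψ]
    rw [smul_neg, hA, hB]
    abel

end Letters

/-! ## §3  Assembly: the (3.42)-block `hE` of the bond writer for `O_□`, over the member's geometry -/

section Assembly

variable (b : Module.Basis ι ℝ 𝔸)

/-- `|c_f·a| = |η⁻¹a|` (`|c_f| = η⁻¹`, G-F5a III's `abs_cf_eq`). [cite: Balaban1985BackgroundPropagators, (3.5) p.391, bookkeeping] -/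
theorem abs_cf_mul (i : KIdx d ℓ hd hL b₀ b₁) (a : ℝ) : |i.cf * a| = |((kGeo i).eta)⁻¹ * a| := by
  rw [abs_mul, abs_mul, abs_cf_eq, abs_inv, abs_of_pos (B9BackgroundsKLevelV1.eta_pos_L_one_le_M_pos i).1]

/-- `|c_f²·a| = |η⁻²a|`. [cite: Balaban1985BackgroundPropagators, (3.5) p.391, bookkeeping] -/
theorem abs_cf_sq_mul (i : KIdx d ℓ hd hL b₀ b₁) (a : ℝ) : |i.cf ^ 2 * a| = |((kGeo i).eta ^ 2)⁻¹ * a| := by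
  rw [abs_mul, abs_mul, abs_pow, abs_cf_eq, inv_pow, abs_inv, abs_of_pos (pow_pos (B9BackgroundsKLevelV1.eta_pos_L_one_le_M_pos i).1 2)]

set_option maxHeartbeats 3200000 in
/-- ★★★ **THE (3.42)-BLOCK `hE` OF THE BOND WRITER FOR THE CUBE LETTER `O_□` OF DESIGN (R), BOND SECTOR** (Corollary 3.6 at one cover cube, read at the
member; the `hE` input of `B9Thm310DeltaAIsUnitOfExpansion.eBlock_kernelFamilyBInv_GAY_of_localInverseCubes''` per cube, MODULO the flat right entry):
there are a rate `δ > 0`, a constant `B₀ ≥ 0`, thresholds `M₀, N₀, T₀` and `a₁ > 0` — functions of `d, L, b₀, b₁, M₂, b` only — such that for every member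
above threshold, every cover cube □, every (3.35) cube datum `(u, U, A; Q, C, ξ, Λ)` of G-F7's form (`Q ⊇ NearC(4.375S_j + 1)`, `U^u = e^{iηA}` on the bonds of
`Q`, `|A| ≤ Cξ⁻¹`, `|η⁻¹∂A| ≤ Cξ⁻²` on `Q`, Hermitian type `‖e^{itA}‖ ≤ 1`, `ξ ≤ 5S_jη`, `L^{j+1}η ≤ Λξ`, `sRead C Λ = max(C, C(1+D₁θ))Λ² ≤ a₁`), `u` a
bi-contraction, every background family through `U`, and every `B₂ ≥ 0`, `0 < ρ′ ≤ δ` with the FLAT RIGHT ENTRY `GVK(Ṽ_□)·conj b(∇*_{1,ν}) ≺ B₂·Lⁿη·e^{−ρ′d_□}`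
over the cube sequence's blocks (all `ν`; cell GAPS G-B9-02, displayed): `Δ_{a,□}(Ṽ_□)` is a unit AND
`EBlock (kernelFamilyBInv i B cfg (fun _ => O_□) par) (B₀(1 + B₂)) ((1 − 9∕5000)ρ′) U₁`, `O_□ = locLetterBY i □ parSymY parBY u χ_□ Ṽ_□` — the four (3.42)
entries of `O_□` with the MEMBER's covariant bond derivatives `∇_{U,ν}`, `∇*_{U,ν}`, `Δ_U`, over the member's geometry `(toB6 (geo9K i), ιB∘Δ)`.
[cite: Balaban1985BackgroundPropagators, Cor. 3.6 p.408 l.1–14, (3.87)–(3.89) p.409, p.410 l.14–15, Thm 3.3 p.399 with Thm 3.1 (3.42) p.397, Thm 3.4 p.400, (3.31) p.395, (3.100) p.413;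
Balaban1984PropagatorsII, (2.39)–(2.44) pp.229–230, (2.51)–(2.55) p.232] -/
theorem eBlock_locLetterBY [NormOneClass 𝔸] [DecidableEq ι] (hℓ : 1 ≤ ℓ) (hb₀ : 0 < b₀) (hb₁ : b₀ ≤ b₁) (M₂ : ℝ) (hM₂ : 0 ≤ M₂)
    (hrepr : ∀ (v : 𝔸) (j : ι), |b.repr v j| ≤ M₂ * ‖v‖) :
    ∃ δ B₀ M₀ T₀ : ℝ, ∃ N₀ : ℕ, 0 < δ ∧ 0 ≤ B₀ ∧ ∃ a₁ : ℝ, 0 < a₁ ∧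
    ∀ (i : KIdx d ℓ hd hL b₀ b₁) (c : ↥(cubes (toKT i).D.toDomains)),
      M₀ ≤ ((ℓ : ℝ) + 1) * (toKT i).Mh → N₀ + 1 ≤ (toKT i).R * ((ℓ + 1) * (toKT i).Mh) → T₀ ≤ RM1 i →
    ∀ (u : GaugeY 𝔸 i) (U : CfgY 𝔸 i) (A : AfldY 𝔸 i) (Q : Set (Site (PV d ℓ i.m i.K hd hL) 0)) (C ξ Λ : ℝ),
      0 ≤ C → 0 < ξ → 1 ≤ Λ → ξ ≤ 5 * (SC i c : ℝ) * (kGeo i).eta → LatticeNorms.scaleLen ((ℓ : ℝ) + 1) (kGeo i).eta (c.1.1 + 1) ≤ Λ * ξ →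
      (∀ x : Site (PV d ℓ i.m i.K hd hL) 0, NearC i c (35 * SC i c / 8 + 1) (boxEquiv i.hN x).1 → x ∈ Q) →
      (∀ (κ : Fin (d + 1)) (x : Site (PV d ℓ i.m i.K hd hL) 0), x ∈ Q → x.shift κ ∈ Q → gaugeY i u U κ x = fluct (kGeo i).eta A κ x) →
      (∀ κ, ∀ x ∈ Q, ‖A κ x‖ ≤ C * ξ⁻¹) →
      (∀ μ ν, ∀ x ∈ Q, ‖(((kGeo i).eta : ℂ)⁻¹) • covD (shiftsV1 (PV d ℓ i.m i.K hd hL)) (fun _ _ => (1 : 𝔸ˣ)) μ (A ν) x‖ ≤ C * (ξ ^ 2)⁻¹) →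
      (∀ (t : ℝ) (κ : Fin (d + 1)) (x : Site (PV d ℓ i.m i.K hd hL) 0), ‖NormedSpace.exp ((Complex.I * (t : ℂ)) • A κ x)‖ ≤ 1) →
      sRead C Λ ≤ a₁ →
      (∀ x, ‖((u x : 𝔸ˣ) : 𝔸)‖ ≤ 1 ∧ ‖(((u x)⁻¹ : 𝔸ˣ) : 𝔸)‖ ≤ 1) →
    ∀ [Fintype (geo9K i).Site] (ιB : BlkY i → IBondY i) (_ : ∀ s, β i.hN i.D i.hk (ιB s) = s) (Rr : ℝ) (Hp : Prop)
      {B : B9.Backgrounds} (cfg : B.Cfg → CfgY 𝔸 i) (par : BondParY 𝔸 i) (U₁ : B.Cfg), cfg U₁ = U →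
    ∀ (B₂ ρ' : ℝ), 0 ≤ B₂ → 0 < ρ' → ρ' ≤ δ →
      (∀ ν : Fin (d + 1), HasMajorant (g := toB6 (geoCK i c) Rr Hp) (blkBK i c)
        (GVK b i c (parSymY i) (parBY i) (locCfgY i c (kGeo i).eta A) * conj b (cdsBₗ i (fun _ _ => (1 : 𝔸ˣ)) ν))
        (fun a a' => B₂ * (geoCK i c).len a * Real.exp (-(ρ' * (geoCK i c).dist a a')))) →
      IsUnit (deltaACubeY i c (parSymY i) (parBY i) (locCfgY i c (kGeo i).eta A)) ∧
      EBlock (kernelFamilyBInv i B cfg (fun _ => locLetterBY i c (parSymY i) (parBY i) u (chiY i c) (locCfgY i c (kGeo i).eta A)) par)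
        (B₀ * (1 + B₂)) ((1 - 9 / 5000) * ρ') U₁ := by
  classical
  have hSb0 : 0 ≤ ∑ j, ‖b j‖ := Finset.sum_nonneg fun _ _ => norm_nonneg _
  have hD1 := D1_nonneg contDiff_thetaProf hasCompactSupport_thetaProf
  have hD2 := D2_nonneg contDiff_thetaProf hasCompactSupport_thetaProf
  obtain ⟨δ, Bf, M₀, T₀, N₀, hδ, hBf, a₁, ha₁, Hc⟩ := B9Cor36GCubeEntriesAtV.cor36_G_cube_entries_at_locCfg' b hℓ hb₀ hb₁ M₂ hM₂ hrepr
  -- the constants: `P = (M₂Σ‖b_j‖)²`, `Λ4 = L⁴`, one constant per writer entry (the `∇*`-entry's at `B₂ = 0`), `Bc₀` their sum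
  obtain ⟨P, hP⟩ : ∃ P : ℝ, P = (M₂ * ∑ j, ‖b j‖) ^ 2 := ⟨_, rfl⟩
  have hP0 : 0 ≤ P := by rw [hP]; positivity
  obtain ⟨Λ4, hΛ4⟩ : ∃ Λ4 : ℝ, Λ4 = ((ℓ : ℝ) + 1) ^ 4 := ⟨_, rfl⟩
  have hΛ40 : 0 ≤ Λ4 := by rw [hΛ4]; positivity
  obtain ⟨C0, hC0⟩ : ∃ C0 : ℝ, C0 = P * (1 * 1 * Bf) := ⟨_, rfl⟩
  obtain ⟨C1, hC1⟩ : ∃ C1 : ℝ, C1 = P * (1 * 1 * Bf) + P * (D1 thetaProf / 4 * 1 * Bf) := ⟨_, rfl⟩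
  obtain ⟨C2, hC2⟩ : ∃ C2 : ℝ, C2 = P * (1 * 1 * Bf) + P * (1 * (D1 thetaProf / 4) * Bf * Λ4) := ⟨_, rfl⟩
  obtain ⟨C3, hC3⟩ : ∃ C3 : ℝ, C3 = P * (1 * 1 * Bf) +
      ((d : ℝ) + 1) * (P * (D1 thetaProf / 4 * 1 * Bf) + P * (D1 thetaProf / 4 * 1 * Bf) + P * (3 * D2 thetaProf / 16 * 1 * Bf)) := ⟨_, rfl⟩
  have hC00 : 0 ≤ C0 := by rw [hC0]; positivity
  have hC10 : 0 ≤ C1 := by rw [hC1]; positivity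
  have hC20 : 0 ≤ C2 := by rw [hC2]; positivity
  have hC30 : 0 ≤ C3 := by rw [hC3]; positivity
  obtain ⟨Bc₀, hBc₀⟩ : ∃ Bc₀ : ℝ, Bc₀ = C0 + C1 + C2 + C3 := ⟨_, rfl⟩
  have hBc₀0 : 0 ≤ Bc₀ := by rw [hBc₀]; positivity
  refine ⟨δ, M₂ * (∑ j, ‖b j‖) * (Bc₀ + P), M₀, max T₀ (4 * Real.log ((ℓ : ℝ) + 1) / (9 / 5000 * δ)), N₀, hδ,
    mul_nonneg (mul_nonneg hM₂ hSb0) (add_nonneg hBc₀0 hP0), a₁, ha₁, ?_⟩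
  intro i c hM hN hT u U A Q C ξ Λ hC hξ hΛ hξS hΛξ hQ hgA hA hdA hAu hsa hg _ ιB hι Rr Hp B cfg par U₁ hcfg B₂ ρ' hB₂ hρ' hρ'δ hR
  have hT₀ : T₀ ≤ RM1 i := (le_max_left _ _).trans hT
  have hTS : 4 * Real.log ((ℓ : ℝ) + 1) / (9 / 5000 * δ) ≤ RM1 i := (le_max_right _ _).trans hT
  obtain ⟨hunit, E0, E1, E1s, E3, E2t⟩ := Hc i c Rr Hp hM hN hT₀ A Q C ξ Λ hC hξ hΛ hξS hΛξ hQ hA hdA hAu hsa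
  refine ⟨hunit, ?_⟩
  -- the writer constant at this `B₂`
  obtain ⟨Bc, hBc⟩ : ∃ Bc : ℝ, Bc = (Bc₀ + P) * (1 + B₂) := ⟨_, rfl⟩
  have hPB : 0 ≤ P * B₂ := mul_nonneg hP0 hB₂
  have hBcge : Bc₀ + P * B₂ ≤ Bc := by rw [hBc]; nlinarith [mul_nonneg hBc₀0 hB₂]
  have hBc0 : 0 ≤ Bc := by rw [hBc]; positivity
  have hc0 : C0 ≤ Bc := by rw [hBc₀] at hBcge; linarith
  have hc1 : C1 ≤ Bc := by rw [hBc₀] at hBcge; linarith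
  have hc2 : P * (1 * 1 * (B₂ + Bf)) + P * (1 * (D1 thetaProf / 4) * Bf * Λ4) ≤ Bc := by
    have e : P * (1 * 1 * (B₂ + Bf)) + P * (1 * (D1 thetaProf / 4) * Bf * Λ4) = C2 + P * B₂ := by rw [hC2]; ring
    rw [e]; rw [hBc₀] at hBcge; linarith
  have hc3 : C3 ≤ Bc := by rw [hBc₀] at hBcge; linarith
  -- the final rate
  have hδE0 : 0 < (1 - 9 / 5000) * ρ' := by positivity
  have hδEρ : (1 - 9 / 5000) * ρ' ≤ ρ' := by nlinarith
  have hδEδ : (1 - 9 / 5000) * ρ' ≤ δ := hδEρ.trans hρ'δ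
  have hδEt : (1 - 9 / 5000) * ρ' ≤ (1 - 9 / 5000) * δ := by nlinarith
  -- the inputs of G-F6b-T
  have hγ : ∀ (f : FBondY i) (a : 𝔸), ‖R (gBondY i u f) a‖ ≤ ‖a‖ ∧ ‖R (gBondY i u f)⁻¹ a‖ ≤ ‖a‖ := fun f a =>
    ⟨B9Eq310Hermitian.norm_R_le (hg _).1 (hg _).2 a, B9Eq310Hermitian.norm_R_inv_le (hg _).1 (hg _).2 a⟩
  have hNz := nearC_of_chiY_ne_zero₃ i c
  have hAG := agree_near i c (kGeo i).eta hQ hgA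
  have hST := (hST_geoCK i c hδ hTS (9 / 5000) le_rfl).2.2.1
  have hl : ∀ a : IBondY i, 0 ≤ (geo9K i).len a := fun a => (B6KLevelCensusIndexV1.len_pos i a).le
  -- the cube entries in the form `conj b (X * GinB)`, `conj b (GinB * X)`
  set V := locCfgY i c (kGeo i).eta A with hVdef
  have E0' : HasMajorant (g := toB6 (geoCK i c) Rr Hp) (blkBK i c) (conj b (GinB i c A))
      (fun a a' => Bf * (geoCK i c).len a ^ 2 * Real.exp (-(δ * (geoCK i c).dist a a'))) := E0
  have E1' : ∀ μ : Fin (d + 1), HasMajorant (g := toB6 (geoCK i c) Rr Hp) (blkBK i c) (conj b (cdBₗ i V μ * GinB i c A))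
      (fun a a' => Bf * (geoCK i c).len a ^ 1 * Real.exp (-(δ * (geoCK i c).dist a a'))) := fun μ => by
    simpa only [pow_one, B9Eq352DivFormLetters.conj_mul, conj_GinB] using E1 μ
  have E1s' : ∀ μ : Fin (d + 1), HasMajorant (g := toB6 (geoCK i c) Rr Hp) (blkBK i c) (conj b (cdsBₗ i V μ * GinB i c A))
      (fun a a' => Bf * (geoCK i c).len a ^ 1 * Real.exp (-(δ * (geoCK i c).dist a a'))) := fun μ => by
    simpa only [pow_one, B9Eq352DivFormLetters.conj_mul, conj_GinB] using E1s μ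
  have E2' : ∀ μ : Fin (d + 1), HasMajorant (g := toB6 (geoCK i c) Rr Hp) (blkBK i c) (conj b (GinB i c A * cdsBₗ i V μ))
      (fun a a' => (B₂ + Bf) * (geoCK i c).len a ^ 1 * Real.exp (-(ρ' * (geoCK i c).dist a a'))) := fun μ => by
    simpa only [pow_one, B9Eq352DivFormLetters.conj_mul, conj_GinB] using E2t μ B₂ ρ' hB₂ hρ'.le hρ'δ (hR μ)
  have E3' : HasMajorant (g := toB6 (geoCK i c) Rr Hp) (blkBK i c) (conj b (lapBₗ i V * GinB i c A))
      (fun a a' => Bf * (geoCK i c).len a ^ 0 * Real.exp (-(δ * (geoCK i c).dist a a'))) := by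
    simpa only [pow_zero, B9Eq352DivFormLetters.conj_mul, conj_GinB] using E3
  -- the multiplier sizes (p33's FILE 7b-D1, read at `f₋`) and the supports (`NearH`)
  have hχ : ∀ f : FBondY i, |hBdY i (chiY i c) f| ≤ 1 := fun f => (abs_chiY_le_one i c _).1
  have hχ0 : ∀ f : FBondY i, |hBdY i (chiY i c) f| * (geoCK i c).len (blkCubeY i c (chartY i f.src)) ^ 0 ≤ 1 := fun f => by
    rw [pow_zero, mul_one]; exact hχ f
  have hχp : ∀ (μ : Fin (d + 1)) (f : FBondY i), |hBdY i (fun z => chiY i c (shiftY i μ z)) f| ≤ 1 := fun μ f =>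
    (chiY_weights i c μ (chartY i f.src)).2.1
  have hχp0 : ∀ (μ : Fin (d + 1)) (f : FBondY i), |hBdY i (fun z => chiY i c (shiftY i μ z)) f| * (geoCK i c).len (blkCubeY i c (chartY i f.src)) ^ 0 ≤ 1 :=
    fun μ f => by rw [pow_zero, mul_one]; exact hχp μ f
  have hdp1 : ∀ (μ : Fin (d + 1)) (f : FBondY i),
      |hBdY i (fun z => i.cf * (chiY i c (shiftY i μ z) - chiY i c z)) f| * (geoCK i c).len (blkCubeY i c (chartY i f.src)) ^ 1 ≤ D1 thetaProf / 4 :=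
    fun μ f => by simp only [hBdY_apply, pow_one]; rw [abs_cf_mul]; exact (chiY_weights i c μ (chartY i f.src)).2.2.2.1
  have hdp1' : ∀ (μ : Fin (d + 1)) (f : FBondY i),
      |hBdY i (fun z => i.cf * (chiY i c (shiftY i μ z) - chiY i c z)) f| * (geoCK i c).len (blkCubeY i c (chartY i f.src)) ≤ D1 thetaProf / 4 :=
    fun μ f => by simp only [hBdY_apply]; rw [abs_cf_mul]; exact (chiY_weights i c μ (chartY i f.src)).2.2.2.1
  have hdm1 : ∀ (μ : Fin (d + 1)) (f : FBondY i),
      |hBdY i (fun z => i.cf * (chiY i c ((shiftY i μ).symm z) - chiY i c z)) f| * (geoCK i c).len (blkCubeY i c (chartY i f.src)) ^ 1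
        ≤ D1 thetaProf / 4 :=
    fun μ f => by simp only [hBdY_apply, pow_one]; rw [abs_cf_mul]; exact (chiY_weights i c μ (chartY i f.src)).2.2.2.2.1
  have hdd2 : ∀ (μ : Fin (d + 1)) (f : FBondY i),
      |hBdY i (fun z => i.cf ^ 2 * (chiY i c (shiftY i μ z) - 2 * chiY i c z + chiY i c ((shiftY i μ).symm z))) f|
        * (geoCK i c).len (blkCubeY i c (chartY i f.src)) ^ 2 ≤ 3 * D2 thetaProf / 16 :=
    fun μ f => by simp only [hBdY_apply]; rw [abs_cf_sq_mul]; exact (chiY_weights i c μ (chartY i f.src)).2.2.2.2.2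
  have hnχ : ∀ f : FBondY i, hBdY i (chiY i c) f ≠ 0 → NearH c (chartY i f.src).1 := fun f hf =>
    nearH_of_chiY_ne_zero₃ i c 0 (chartY i f.src) (Or.inl hf)
  have hnχp : ∀ (μ : Fin (d + 1)) (f : FBondY i), hBdY i (fun z => chiY i c (shiftY i μ z)) f ≠ 0 → NearH c (chartY i f.src).1 := fun μ f hf =>
    nearH_of_chiY_ne_zero₃ i c μ (chartY i f.src) (Or.inr (Or.inl hf))
  have hndn : ∀ (μ : Fin (d + 1)) (f : FBondY i), hBdY i (fun z => i.cf * (chiY i c (shiftY i μ z) - chiY i c z)) f ≠ 0 → NearH c (chartY i f.src).1 := by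
    intro μ f hf
    refine nearH_of_chiY_ne_zero₃ i c μ (chartY i f.src) ?_
    by_contra hcon
    simp only [not_or, not_ne_iff] at hcon
    exact hf (by simp only [hBdY_apply]; rw [hcon.1, hcon.2.1, sub_self, mul_zero])
  -- (3.42)₁: `O_□ = Sand(χ, G_□, χ)`
  have W0 : HasMajorant (g := toB6 (geo9K i) Rr Hp) (fun p : FBondY i × ι => ιB (blkV1 i.hN i.D p.1)) (conj b (GmemB i c u A))
      (fun a a' => Bc * (geo9K i).len a ^ 2 * Real.exp (-((1 - 9 / 5000) * ρ' * (geo9K i).dist a a'))) := by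
    have T := hasMajorant_conj_bond_sandwich_decay i c b hM₂ hrepr (gBondY i u) hγ (hBdY i (chiY i c)) (hBdY i (chiY i c)) (c₁ := 1) (c₂ := 1)
      zero_le_one zero_le_one (m := 0) (n := 2) (by norm_num) hχ0 hχ hnχ ιB hι Rr Hp Rr Hp hBf hδ.le (GinB i c A) E0'
    refine hasMajorant_mono (g := toB6 (geo9K i) Rr Hp) _ T fun a a' => ?_
    rw [← hP, ← hC0]
    exact kernel_le (geo9K_dist_nonneg i a a') (pow_nonneg (hl a) _) (le_of_eq (by norm_num)) hc0 hBc0 hδEδ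
  -- (3.42)₂: `∇_{U,μ}·O_□`
  have W1 : ∀ μ : Fin (d + 1), HasMajorant (g := toB6 (geo9K i) Rr Hp) (fun p : FBondY i × ι => ιB (blkV1 i.hN i.D p.1))
      (conj b (cdBₗ i U μ) * conj b (GmemB i c u A))
      (fun a a' => Bc * (geo9K i).len a * Real.exp (-((1 - 9 / 5000) * ρ' * (geo9K i).dist a a'))) := by
    intro μ
    have Ta := hasMajorant_conj_bond_sandwich_decay i c b hM₂ hrepr (gBondY i u) hγ (hBdY i (fun z => chiY i c (shiftY i μ z))) (hBdY i (chiY i c))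
      (c₁ := 1) (c₂ := 1) zero_le_one zero_le_one (m := 0) (n := 1) (by norm_num) (hχp0 μ) hχ hnχ ιB hι Rr Hp Rr Hp hBf hδ.le
      (cdBₗ i V μ * GinB i c A) (E1' μ)
    have Tb := hasMajorant_conj_bond_sandwich_decay i c b hM₂ hrepr (gBondY i u) hγ
      (hBdY i (fun z => i.cf * (chiY i c (shiftY i μ z) - chiY i c z))) (hBdY i (chiY i c)) (c₁ := D1 thetaProf / 4) (c₂ := 1) (by positivity)
      zero_le_one (m := 1) (n := 2) (by norm_num) (hdp1 μ) hχ hnχ ιB hι Rr Hp Rr Hp hBf hδ.le (GinB i c A) E0'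
    have hs := hasMajorant_congr_op (T' := conj b (cdBₗ i U μ) * conj b (GmemB i c u A)) (hasMajorant_add _ Ta Tb)
      (by rw [← B9Eq352DivFormLetters.conj_mul, cdBₗ_mul_GmemB i c u U A hNz hAG μ, conj_add])
    refine hasMajorant_mono (g := toB6 (geo9K i) Rr Hp) _ hs fun a a' => ?_
    have hd := geo9K_dist_nonneg i a a'
    calc (M₂ * ∑ j, ‖b j‖) ^ 2 * (1 * 1 * Bf) * (geo9K i).len a ^ (1 - 0) * Real.exp (-(δ * (geo9K i).dist a a'))
          + (M₂ * ∑ j, ‖b j‖) ^ 2 * (D1 thetaProf / 4 * 1 * Bf) * (geo9K i).len a ^ (2 - 1) * Real.exp (-(δ * (geo9K i).dist a a'))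
        ≤ P * (1 * 1 * Bf) * (geo9K i).len a * Real.exp (-((1 - 9 / 5000) * ρ' * (geo9K i).dist a a'))
          + P * (D1 thetaProf / 4 * 1 * Bf) * (geo9K i).len a * Real.exp (-((1 - 9 / 5000) * ρ' * (geo9K i).dist a a')) := by
          rw [hP]
          exact add_le_add (kernel_le hd (pow_nonneg (hl a) _) (le_of_eq (by norm_num)) le_rfl (by positivity) hδEδ)
            (kernel_le hd (pow_nonneg (hl a) _) (le_of_eq (by norm_num)) le_rfl (by positivity) hδEδ)
      _ = C1 * (geo9K i).len a * Real.exp (-((1 - 9 / 5000) * ρ' * (geo9K i).dist a a')) := by rw [hC1]; ring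
      _ ≤ Bc * (geo9K i).len a * Real.exp (-((1 - 9 / 5000) * ρ' * (geo9K i).dist a a')) :=
          mul_le_mul_of_nonneg_right (mul_le_mul_of_nonneg_right hc1 (hl a)) (Real.exp_nonneg _)
  -- (3.42)₃: `O_□·∇*_{U,μ}`
  have W2 : ∀ μ : Fin (d + 1), HasMajorant (g := toB6 (geo9K i) Rr Hp) (fun p : FBondY i × ι => ιB (blkV1 i.hN i.D p.1))
      (conj b (GmemB i c u A) * conj b (cdsBₗ i U μ))
      (fun a a' => Bc * (geo9K i).len a * Real.exp (-((1 - 9 / 5000) * ρ' * (geo9K i).dist a a'))) := by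
    intro μ
    have Ta := hasMajorant_conj_bond_sandwich_decay i c b hM₂ hrepr (gBondY i u) hγ (hBdY i (chiY i c)) (hBdY i (fun z => chiY i c (shiftY i μ z)))
      (c₁ := 1) (c₂ := 1) zero_le_one zero_le_one (m := 0) (n := 1) (by norm_num) hχ0 (hχp μ) (hnχp μ) ιB hι Rr Hp Rr Hp (add_nonneg hB₂ hBf) hρ'.le
      (GinB i c A * cdsBₗ i V μ) (E2' μ)
    have Tb := hasMajorant_conj_bond_sandwich_decay_src i c b hM₂ hrepr (gBondY i u) hγ (hBdY i (chiY i c))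
      (hBdY i (fun z => i.cf * (chiY i c (shiftY i μ z) - chiY i c z))) (c₁ := 1) (c₂ := D1 thetaProf / 4) zero_le_one (by positivity)
      hχ (hdp1' μ) (hndn μ) ιB hι Rr Hp Rr Hp hBf hδ.le (by norm_num : (9 : ℝ) / 5000 ≤ 1) hΛ40
      (by rw [hΛ4]; exact hST) (GinB i c A) E0'
    have hs := hasMajorant_congr_op (T' := conj b (GmemB i c u A) * conj b (cdsBₗ i U μ)) (hasMajorant_add _ Ta Tb)
      (by rw [← B9Eq352DivFormLetters.conj_mul, GmemB_mul_cdsBₗ i c u U A hNz hAG μ, conj_add])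
    refine hasMajorant_mono (g := toB6 (geo9K i) Rr Hp) _ hs fun a a' => ?_
    have hd := geo9K_dist_nonneg i a a'
    calc (M₂ * ∑ j, ‖b j‖) ^ 2 * (1 * 1 * (B₂ + Bf)) * (geo9K i).len a ^ (1 - 0) * Real.exp (-(ρ' * (geo9K i).dist a a'))
          + (M₂ * ∑ j, ‖b j‖) ^ 2 * (1 * (D1 thetaProf / 4) * Bf * Λ4) * (geo9K i).len a *
            Real.exp (-((1 - 9 / 5000) * δ * (geo9K i).dist a a'))
        ≤ P * (1 * 1 * (B₂ + Bf)) * (geo9K i).len a * Real.exp (-((1 - 9 / 5000) * ρ' * (geo9K i).dist a a'))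
          + P * (1 * (D1 thetaProf / 4) * Bf * Λ4) * (geo9K i).len a * Real.exp (-((1 - 9 / 5000) * ρ' * (geo9K i).dist a a')) := by
          rw [hP]
          exact add_le_add (kernel_le hd (pow_nonneg (hl a) _) (le_of_eq (by norm_num)) le_rfl (by positivity) hδEρ)
            (kernel_le hd (hl a) le_rfl le_rfl (by positivity) hδEt)
      _ = (P * (1 * 1 * (B₂ + Bf)) + P * (1 * (D1 thetaProf / 4) * Bf * Λ4)) * (geo9K i).len a *
            Real.exp (-((1 - 9 / 5000) * ρ' * (geo9K i).dist a a')) := by ring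
      _ ≤ Bc * (geo9K i).len a * Real.exp (-((1 - 9 / 5000) * ρ' * (geo9K i).dist a a')) :=
          mul_le_mul_of_nonneg_right (mul_le_mul_of_nonneg_right hc2 (hl a)) (Real.exp_nonneg _)
  -- (3.42)₄: `Δ_U·O_□`
  have W3 : HasMajorant (g := toB6 (geo9K i) Rr Hp) (fun p : FBondY i × ι => ιB (blkV1 i.hN i.D p.1))
      (conj b (lapBₗ i U) * conj b (GmemB i c u A))
      (fun a a' => Bc * 1 * Real.exp (-((1 - 9 / 5000) * ρ' * (geo9K i).dist a a'))) := by
    have T0 := hasMajorant_conj_bond_sandwich_decay i c b hM₂ hrepr (gBondY i u) hγ (hBdY i (chiY i c)) (hBdY i (chiY i c)) (c₁ := 1) (c₂ := 1)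
      zero_le_one zero_le_one (m := 0) (n := 0) le_rfl hχ0 hχ hnχ ιB hι Rr Hp Rr Hp hBf hδ.le (lapBₗ i V * GinB i c A) E3'
    have Ta := fun μ : Fin (d + 1) => hasMajorant_conj_bond_sandwich_decay i c b hM₂ hrepr (gBondY i u) hγ
      (hBdY i (fun z => i.cf * (chiY i c ((shiftY i μ).symm z) - chiY i c z))) (hBdY i (chiY i c)) (c₁ := D1 thetaProf / 4) (c₂ := 1)
      (by positivity) zero_le_one (m := 1) (n := 1) le_rfl (hdm1 μ) hχ hnχ ιB hι Rr Hp Rr Hp hBf hδ.le (cdsBₗ i V μ * GinB i c A) (E1s' μ)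
    have Tb := fun μ : Fin (d + 1) => hasMajorant_conj_bond_sandwich_decay i c b hM₂ hrepr (gBondY i u) hγ
      (hBdY i (fun z => i.cf * (chiY i c (shiftY i μ z) - chiY i c z))) (hBdY i (chiY i c)) (c₁ := D1 thetaProf / 4) (c₂ := 1)
      (by positivity) zero_le_one (m := 1) (n := 1) le_rfl (hdp1 μ) hχ hnχ ιB hι Rr Hp Rr Hp hBf hδ.le (cdBₗ i V μ * GinB i c A) (E1' μ)
    have Tc := fun μ : Fin (d + 1) => hasMajorant_conj_bond_sandwich_decay i c b hM₂ hrepr (gBondY i u) hγ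
      (hBdY i (fun z => i.cf ^ 2 * (chiY i c (shiftY i μ z) - 2 * chiY i c z + chiY i c ((shiftY i μ).symm z)))) (hBdY i (chiY i c))
      (c₁ := 3 * D2 thetaProf / 16) (c₂ := 1) (by positivity) zero_le_one (m := 2) (n := 2) le_rfl (hdd2 μ) hχ hnχ ιB hι Rr Hp Rr Hp hBf
      hδ.le (GinB i c A) E0'
    have Tsum := hasMajorant_finset_sum (g := toB6 (geo9K i) Rr Hp) (fun p : FBondY i × ι => ιB (blkV1 i.hN i.D p.1)) Finset.univ _ _
      fun μ _ => hasMajorant_add _ (hasMajorant_add _ (Ta μ) (Tb μ)) (Tc μ)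
    have hs0 := hasMajorant_add _ T0 (hasMajorant_neg _ Tsum)
    rw [← sub_eq_add_neg] at hs0
    have hs := hasMajorant_congr_op (T' := conj b (lapBₗ i U) * conj b (GmemB i c u A)) hs0 (by
      rw [← B9Eq352DivFormLetters.conj_mul, lapBₗ_mul_GmemB i c u U A hNz hAG, conj_sub, conj_finset_sum]
      simp only [conj_add, SandB, hVdef])
    refine hasMajorant_mono (g := toB6 (geo9K i) Rr Hp) _ hs fun a a' => ?_
    have hd := geo9K_dist_nonneg i a a'
    have per : ∀ μ : Fin (d + 1),
        (M₂ * ∑ j, ‖b j‖) ^ 2 * (D1 thetaProf / 4 * 1 * Bf) * (geo9K i).len a ^ (1 - 1) * Real.exp (-(δ * (geo9K i).dist a a'))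
          + (M₂ * ∑ j, ‖b j‖) ^ 2 * (D1 thetaProf / 4 * 1 * Bf) * (geo9K i).len a ^ (1 - 1) * Real.exp (-(δ * (geo9K i).dist a a'))
          + (M₂ * ∑ j, ‖b j‖) ^ 2 * (3 * D2 thetaProf / 16 * 1 * Bf) * (geo9K i).len a ^ (2 - 2) * Real.exp (-(δ * (geo9K i).dist a a'))
        ≤ (P * (D1 thetaProf / 4 * 1 * Bf) + P * (D1 thetaProf / 4 * 1 * Bf) + P * (3 * D2 thetaProf / 16 * 1 * Bf)) * 1 *
            Real.exp (-((1 - 9 / 5000) * ρ' * (geo9K i).dist a a')) := by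
      intro μ
      rw [hP]
      calc _ ≤ (M₂ * ∑ j, ‖b j‖) ^ 2 * (D1 thetaProf / 4 * 1 * Bf) * 1 * Real.exp (-((1 - 9 / 5000) * ρ' * (geo9K i).dist a a'))
            + (M₂ * ∑ j, ‖b j‖) ^ 2 * (D1 thetaProf / 4 * 1 * Bf) * 1 * Real.exp (-((1 - 9 / 5000) * ρ' * (geo9K i).dist a a'))
            + (M₂ * ∑ j, ‖b j‖) ^ 2 * (3 * D2 thetaProf / 16 * 1 * Bf) * 1 * Real.exp (-((1 - 9 / 5000) * ρ' * (geo9K i).dist a a')) :=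
            add_le_add (add_le_add (kernel_le hd (pow_nonneg (hl a) _) (le_of_eq (by norm_num)) le_rfl (by positivity) hδEδ)
              (kernel_le hd (pow_nonneg (hl a) _) (le_of_eq (by norm_num)) le_rfl (by positivity) hδEδ))
              (kernel_le hd (pow_nonneg (hl a) _) (le_of_eq (by norm_num)) le_rfl (by positivity) hδEδ)
        _ = _ := by ring
    calc (M₂ * ∑ j, ‖b j‖) ^ 2 * (1 * 1 * Bf) * (geo9K i).len a ^ (0 - 0) * Real.exp (-(δ * (geo9K i).dist a a'))
          + ∑ μ : Fin (d + 1),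
            ((M₂ * ∑ j, ‖b j‖) ^ 2 * (D1 thetaProf / 4 * 1 * Bf) * (geo9K i).len a ^ (1 - 1) * Real.exp (-(δ * (geo9K i).dist a a'))
              + (M₂ * ∑ j, ‖b j‖) ^ 2 * (D1 thetaProf / 4 * 1 * Bf) * (geo9K i).len a ^ (1 - 1) * Real.exp (-(δ * (geo9K i).dist a a'))
              + (M₂ * ∑ j, ‖b j‖) ^ 2 * (3 * D2 thetaProf / 16 * 1 * Bf) * (geo9K i).len a ^ (2 - 2) * Real.exp (-(δ * (geo9K i).dist a a')))
        ≤ P * (1 * 1 * Bf) * 1 * Real.exp (-((1 - 9 / 5000) * ρ' * (geo9K i).dist a a'))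
          + ∑ _μ : Fin (d + 1), (P * (D1 thetaProf / 4 * 1 * Bf) + P * (D1 thetaProf / 4 * 1 * Bf) + P * (3 * D2 thetaProf / 16 * 1 * Bf)) * 1 *
            Real.exp (-((1 - 9 / 5000) * ρ' * (geo9K i).dist a a')) := by
          refine add_le_add ?_ (Finset.sum_le_sum fun μ _ => per μ)
          rw [hP]
          exact kernel_le hd (pow_nonneg (hl a) _) (le_of_eq (by norm_num)) le_rfl (by positivity) hδEδ
      _ = C3 * 1 * Real.exp (-((1 - 9 / 5000) * ρ' * (geo9K i).dist a a')) := by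
          rw [Finset.sum_const, Finset.card_univ, Fintype.card_fin, nsmul_eq_mul, hC3]; push_cast; ring
      _ ≤ Bc * 1 * Real.exp (-((1 - 9 / 5000) * ρ' * (geo9K i).dist a a')) :=
          mul_le_mul_of_nonneg_right (mul_le_mul_of_nonneg_right hc3 zero_le_one) (Real.exp_nonneg _)
  -- the writer
  have key := eBlock_kernelFamilyBInv_of_hasMajorant (i := i) (b := b) (cfg := cfg)
    (O := fun _ => locLetterBY i c (parSymY i) (parBY i) u (chiY i c) (locCfgY i c (kGeo i).eta A)) (par := par) (U₁ := U₁) (Rr := Rr) (Hp := Hp)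
    ιB hι hM₂ hrepr (GmemB i c u A) (fun Λ => GmemB_apply i c u A Λ) (cdBₗ i U) (cdsBₗ i U) (fun ν Λ => by rw [cdBₗ_apply, hcfg])
    (fun ν Λ => by rw [cdsBₗ_apply, hcfg]) (lapBₗ i U) (fun Λ => by rw [lapBₗ_apply, hcfg]) hBc0 W0 W1 W2 W3
  have e : M₂ * (∑ j, ‖b j‖) * Bc = M₂ * (∑ j, ‖b j‖) * (Bc₀ + P) * (1 + B₂) := by rw [hBc]; ring
  rw [e] at key
  exact key

end Assembly

end Literature.MathematicalPhysics.QuantumFieldTheory.Balaban1983to89.B9Cor36GCubeLocAtMember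

end
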